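import Literature.NumberTheory.Automorphic.IwasawaDecompositionGL          -- ★ `exists_unipotent_mul_zpowDiagGL_mul_glInt`, `zpowDiagGL`, `IsUniformizingElement.eq_zero_of_zpow_mem`
import Literature.NumberTheory.Automorphic.FixedCosetsStableLattices       -- ★ (D4½) `span_range_transpose_eq_iff`, `map_span_range_transpose_eq_self_iff`
import HarnessLib

/-!
# Lattices in the plane `F²` in HERMITE FORM `Λ = 𝒪·(ϖ^k, 0) + 𝒪·(y, ϖ^l)`: existence, uniqueness of `(k, l, y mod ϖ^k 𝒪)`, and stability
# under a diagonal `diag(a, c)` ⟺ `(a − c) y ∈ ϖ^k 𝒪` (Macdonald, *Symmetric functions and Hall polynomials*, Ch. II §1, Ch. V §2; Bump, Prop. 4.5.2)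

Topic `NumberTheory/Automorphic`; namespace `Literature.NumberTheory.Automorphic`.  THEOREMS ONLY (no definition, no instance, no notation, no named fact,
no `sorry`).  Cell `pub/hodgecm-mathlib`, F0∕P3a road «D-N7-inert», brick **(L5-a)** of the H-side count (L5) [Flicker1998UnitaryFL §6 p. 95 + REMARK] (B-p10 (g24)
PRE-CENSUS bf72064b4f0257e1, LEAD F0P3a-plan (g9) T8-35 (C)); the feeder of (L5-b) «self-dual glued lattices» (A-p13 (g30)) and of (L5-d).  HC_CM is proved only
modulo the printed citations until rung 0 closes; nothing printed is a letter here — elementary lattice algebra over a discrete valuation ring.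

SETTING.  `F` a field with a valuative relation, `𝒪 = 𝒪[F]`, `ϖ` a uniformizing element (★ `IsUniformizingElement`); for existence (§4) `𝒪` a discrete
valuation ring.  LATTICES are written in the currency of ★ (D4½) `FixedCosetsStableLattices` and of the lattice-count socket ★ `UnitaryUnitOrbitalIntegralLatticeCount`:
`Λ(g) := Submodule.span 𝒪 (Set.range (↑g)ᵀ)` (the `𝒪`-span of the COLUMNS of `g ∈ GL₂(F)`), the action of `γ` as `Λ ↦ Λ.map (toLin' γ)`.  A HERMITE matrix is
`!![ϖ^k, y; 0, ϖ^l]` (`k l : ℤ`, `y : F`) — columns `(ϖ^k, 0)` and `(y, ϖ^l)`; it is named through a hypothesis `hg : ↑g = !![ϖ^k, y; 0, ϖ^l]` on `g : GL (Fin 2) F`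
(no definition is introduced).

* §1 2×2 algebra of `!![P, y; 0, Q]` (`P Q ≠ 0`): the inverse `!![P⁻¹, −P⁻¹ y Q⁻¹; 0, Q⁻¹]`, `T⁻¹T′`, `T⁻¹ diag(a,c) T = !![a, P⁻¹(a − c) y; 0, c]`; an upper-triangular
  element of `GL₂(F)` lies in `GL₂(𝒪)` iff its diagonal has valuation `1` and its corner is integral (`mem_glInt_of_upperTriangular_iff`); `|ϖ^d| = 1 ↔ d = 0`.
* §2 UNIQUENESS **`span_eq_span_iff_of_hermite`**: `Λ(T(k,y,l)) = Λ(T(k′,y′,l′)) ↔ k = k′ ∧ l = l′ ∧ ϖ^{−k}(y′ − y) ∈ 𝒪` (★ `span_range_transpose_eq_iff` + §1).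
* §3 STABILITY **`map_diag_span_eq_self_iff_of_hermite`**: for units `a, c`, `diag(a,c)·Λ(T(k,y,l)) = Λ(T(k,y,l)) ↔ ϖ^{−k}((a − c) y) ∈ 𝒪` — for `y = ϖ^{−(k+e)}u`,
  `u` a unit, this reads `v(a − c) ≥ 2k + e` = «gap ≤ N» of the PRE-CENSUS (★ `map_span_range_transpose_eq_self_iff` + §1).
* §4 EXISTENCE **`exists_hermite_span_eq`** (DVR): every `Λ(h)`, `h ∈ GL₂(F)`, is `Λ(T(k,y,l))` for some `k l : ℤ`, `y : F` (the Iwasawa decomposition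
  `h = u ϖ^m κ`, ★ `exists_unipotent_mul_zpowDiagGL_mul_glInt`, read at `n = 2`).

## References
* [Macdonald1995] I. G. Macdonald, *Symmetric functions and Hall polynomials*, 2nd ed. (1995), Ch. II §1 (1.4)–(1.6), Ch. V §2 (2.6)–(2.9).
* [Bump1997] D. Bump, *Automorphic Forms and Representations* (1997), Prop. 4.5.2 (Iwasawa decomposition of `GL_n` over a local field).
* [Flicker1998UnitaryFL] Y. Z. Flicker, *Elementary proof of the fundamental lemma for a unitary group*, Canad. J. Math. 50 (1998), §4 Lemma I.I.1 p. 84, §6 p. 95.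
-/

set_option autoImplicit false

noncomputable section

open scoped ValuativeRel Matrix MatrixGroups
open Matrix ValuativeRel

namespace Literature.NumberTheory.Automorphic

variable {F : Type*} [Field F] [ValuativeRel F] {ϖ : F} (hϖ : IsUniformizingElement ϖ)

/-! ## §1 Algebra of the upper-triangular matrices `!![P, y; 0, Q]` (`P Q ≠ 0`; the Hermite matrices have `P = ϖ^k`, `Q = ϖ^l`) -/

section Algebra

omit [ValuativeRel F] in
/-- The inverse of an invertible upper-triangular `2 × 2` matrix: `!![P, y; 0, Q]⁻¹ = !![P⁻¹, −(P⁻¹ y Q⁻¹); 0, Q⁻¹]`. [cite: Macdonald1995, Ch. II §1] -/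
theorem upperTriangular_inv {P Q : F} (hP : P ≠ 0) (hQ : Q ≠ 0) (y : F) :
    (!![P, y; 0, Q] : Matrix (Fin 2) (Fin 2) F)⁻¹ = !![P⁻¹, -(P⁻¹ * y * Q⁻¹); 0, Q⁻¹] := by
  refine Matrix.inv_eq_left_inv ?_
  have e11 : P⁻¹ * P + -(P⁻¹ * y * Q⁻¹) * 0 = 1 := by rw [mul_zero, add_zero, inv_mul_cancel₀ hP]
  have e12 : P⁻¹ * y + -(P⁻¹ * y * Q⁻¹) * Q = 0 := by rw [neg_mul, mul_assoc (P⁻¹ * y), inv_mul_cancel₀ hQ, mul_one, add_neg_cancel]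
  have e21 : (0 : F) * P + Q⁻¹ * 0 = 0 := by rw [zero_mul, mul_zero, add_zero]
  have e22 : (0 : F) * y + Q⁻¹ * Q = 1 := by rw [zero_mul, zero_add, inv_mul_cancel₀ hQ]
  rw [Matrix.mul_fin_two, e11, e12, e21, e22, Matrix.one_fin_two]

omit [ValuativeRel F] in
/-- `!![P, y; 0, Q]⁻¹ · !![P′, y′; 0, Q′] = !![P⁻¹P′, P⁻¹(y′ − y Q⁻¹ Q′); 0, Q⁻¹ Q′]`. [cite: Macdonald1995, Ch. V §2] -/
theorem upperTriangular_inv_mul {P Q : F} (hP : P ≠ 0) (hQ : Q ≠ 0) (y P' Q' y' : F) :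
    (!![P, y; 0, Q] : Matrix (Fin 2) (Fin 2) F)⁻¹ * !![P', y'; 0, Q'] = !![P⁻¹ * P', P⁻¹ * (y' - y * Q⁻¹ * Q'); 0, Q⁻¹ * Q'] := by
  have e11 : P⁻¹ * P' + -(P⁻¹ * y * Q⁻¹) * 0 = P⁻¹ * P' := by ring
  have e12 : P⁻¹ * y' + -(P⁻¹ * y * Q⁻¹) * Q' = P⁻¹ * (y' - y * Q⁻¹ * Q') := by ring
  have e21 : (0 : F) * P' + Q⁻¹ * 0 = 0 := by ring
  have e22 : (0 : F) * y' + Q⁻¹ * Q' = Q⁻¹ * Q' := by ring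
  rw [upperTriangular_inv hP hQ, Matrix.mul_fin_two, e11, e12, e21, e22]

omit [ValuativeRel F] in
/-- `!![P, y; 0, Q]⁻¹ · diag(a, c) · !![P, y; 0, Q] = !![a, P⁻¹((a − c) y); 0, c]`. [cite: Macdonald1995, Ch. V §2] -/
theorem upperTriangular_inv_mul_diag_mul {P Q : F} (hP : P ≠ 0) (hQ : Q ≠ 0) (y a c : F) :
    (!![P, y; 0, Q] : Matrix (Fin 2) (Fin 2) F)⁻¹ * !![a, 0; 0, c] * !![P, y; 0, Q] = !![a, P⁻¹ * ((a - c) * y); 0, c] := by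
  -- first product `T⁻¹ · diag(a, c)`
  have f11 : P⁻¹ * a + -(P⁻¹ * y * Q⁻¹) * 0 = P⁻¹ * a := by ring
  have f12 : P⁻¹ * 0 + -(P⁻¹ * y * Q⁻¹) * c = -(P⁻¹ * y * Q⁻¹ * c) := by ring
  have f21 : (0 : F) * a + Q⁻¹ * 0 = 0 := by ring
  have f22 : (0 : F) * 0 + Q⁻¹ * c = Q⁻¹ * c := by ring
  -- second product `· T`
  have e11 : P⁻¹ * a * P + -(P⁻¹ * y * Q⁻¹ * c) * 0 = a := by
    rw [mul_zero, add_zero, mul_comm, ← mul_assoc, mul_inv_cancel₀ hP, one_mul]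
  have e12 : P⁻¹ * a * y + -(P⁻¹ * y * Q⁻¹ * c) * Q = P⁻¹ * ((a - c) * y) := by
    have hQQ : Q⁻¹ * c * Q = c := by rw [mul_comm, ← mul_assoc, mul_inv_cancel₀ hQ, one_mul]
    calc P⁻¹ * a * y + -(P⁻¹ * y * Q⁻¹ * c) * Q = P⁻¹ * a * y - P⁻¹ * y * (Q⁻¹ * c * Q) := by ring
      _ = P⁻¹ * ((a - c) * y) := by rw [hQQ]; ring
  have e21 : (0 : F) * P + Q⁻¹ * c * 0 = 0 := by ring
  have e22 : (0 : F) * y + Q⁻¹ * c * Q = c := by rw [zero_mul, zero_add, mul_comm, ← mul_assoc, mul_inv_cancel₀ hQ, one_mul]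
  rw [upperTriangular_inv hP hQ, Matrix.mul_fin_two, f11, f12, f21, f22, Matrix.mul_fin_two, e11, e12, e21, e22]

/-- An UPPER-TRIANGULAR element `g = !![p, q; 0, s] ∈ GL₂(F)` lies in `GL₂(𝒪)` iff `|p| = |s| = 1` and `q ∈ 𝒪` (its inverse is `!![p⁻¹, −p⁻¹ q s⁻¹; 0, s⁻¹]`).
[cite: Macdonald1995, Ch. V §2] -/
theorem mem_glInt_of_upperTriangular_iff (g : GL (Fin 2) F) {p q s : F} (hg : (g : Matrix (Fin 2) (Fin 2) F) = !![p, q; 0, s]) :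
    g ∈ glInt 2 F ↔ valuation F p = 1 ∧ valuation F s = 1 ∧ q ∈ 𝒪[F] := by
  have hdet : (g : Matrix (Fin 2) (Fin 2) F).det = p * s := by rw [hg, Matrix.det_fin_two_of, mul_zero, sub_zero]
  have hdet0 : p * s ≠ 0 := by rw [← hdet]; exact (Matrix.isUnits_det_units g).ne_zero
  have hp : p ≠ 0 := left_ne_zero_of_mul hdet0
  have hs : s ≠ 0 := right_ne_zero_of_mul hdet0
  have hinv : ((g⁻¹ : GL (Fin 2) F) : Matrix (Fin 2) (Fin 2) F) = !![p⁻¹, -(p⁻¹ * q * s⁻¹); 0, s⁻¹] := by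
    rw [Matrix.coe_units_inv, hg, upperTriangular_inv hp hs]
  rw [mem_glInt_iff, hg, hinv]
  constructor
  · rintro ⟨h1, h2⟩
    have hp1 : p ∈ 𝒪[F] := by simpa using h1 0 0
    have hs1 : s ∈ 𝒪[F] := by simpa using h1 1 1
    have hpi : p⁻¹ ∈ 𝒪[F] := by simpa using h2 0 0
    have hsi : s⁻¹ ∈ 𝒪[F] := by simpa using h2 1 1
    refine ⟨?_, ?_, by simpa using h1 0 1⟩
    · refine le_antisymm ((Valuation.mem_integer_iff _ _).1 hp1) ?_
      have h := (Valuation.mem_integer_iff _ _).1 hpi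
      rw [map_inv₀, inv_le_one₀ ((Valuation.pos_iff _).2 hp)] at h
      exact h
    · refine le_antisymm ((Valuation.mem_integer_iff _ _).1 hs1) ?_
      have h := (Valuation.mem_integer_iff _ _).1 hsi
      rw [map_inv₀, inv_le_one₀ ((Valuation.pos_iff _).2 hs)] at h
      exact h
  · rintro ⟨h1, h2, h3⟩
    have hp1 : p ∈ 𝒪[F] := (Valuation.mem_integer_iff _ _).2 h1.le
    have hs1 : s ∈ 𝒪[F] := (Valuation.mem_integer_iff _ _).2 h2.le
    have hpi : p⁻¹ ∈ 𝒪[F] := (Valuation.mem_integer_iff _ _).2 (by rw [map_inv₀, h1, inv_one])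
    have hsi : s⁻¹ ∈ 𝒪[F] := (Valuation.mem_integer_iff _ _).2 (by rw [map_inv₀, h2, inv_one])
    refine ⟨fun i j => ?_, fun i j => ?_⟩
    · fin_cases i <;> fin_cases j
      · simpa using hp1
      · simpa using h3
      · simp
      · simpa using hs1
    · fin_cases i <;> fin_cases j
      · simpa using hpi
      · simpa using (𝒪[F]).neg_mem ((𝒪[F]).mul_mem ((𝒪[F]).mul_mem hpi h3) hsi)
      · simp
      · simpa using hsi

include hϖ in
/-- `|ϖ^d| = 1` iff `d = 0`. [cite: Macdonald1995, Ch. II §1] -/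
theorem valuation_zpow_uniformizer_eq_one_iff (d : ℤ) : valuation F (ϖ ^ d) = 1 ↔ d = 0 := by
  refine ⟨fun h => ?_, fun h => by rw [h, zpow_zero, map_one]⟩
  refine hϖ.eq_zero_of_zpow_mem ((Valuation.mem_integer_iff _ _).2 h.le) ((Valuation.mem_integer_iff _ _).2 ?_)
  rw [_root_.zpow_neg, map_inv₀, h, inv_one]

include hϖ in
/-- `(ϖ^k)⁻¹ ϖ^{k′} = ϖ^{k′−k}`. [cite: Macdonald1995, Ch. II §1] -/
theorem zpow_uniformizer_inv_mul_zpow (k k' : ℤ) : (ϖ ^ k)⁻¹ * ϖ ^ k' = ϖ ^ (k' - k) := by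
  rw [← _root_.zpow_neg, ← zpow_add₀ hϖ.ne_zero, neg_add_eq_sub]

end Algebra

/-! ## §2 Uniqueness of the Hermite data of a lattice -/

section Uniqueness

include hϖ in
/-- **`Λ(T(k,y,l)) = Λ(T(k′,y′,l′)) ↔ k = k′ ∧ l = l′ ∧ ϖ^{−k}(y′ − y) ∈ 𝒪`** — the Hermite data `(k, l, y mod ϖ^k 𝒪)` of a plane lattice are unique
(★ `span_range_transpose_eq_iff`: same lattice iff `T⁻¹T′ ∈ GL₂(𝒪)`; that matrix is upper triangular with diagonal `ϖ^{k′−k}, ϖ^{l′−l}`).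
[cite: Macdonald1995, Ch. V §2 (2.6)–(2.9)] [cite: Flicker1998UnitaryFL, §4 Lemma I.I.1 p. 84] -/
theorem span_eq_span_iff_of_hermite {k l k' l' : ℤ} {y y' : F} (g g' : GL (Fin 2) F)
    (hg : (g : Matrix (Fin 2) (Fin 2) F) = !![ϖ ^ k, y; 0, ϖ ^ l]) (hg' : (g' : Matrix (Fin 2) (Fin 2) F) = !![ϖ ^ k', y'; 0, ϖ ^ l']) :
    Submodule.span 𝒪[F] (Set.range ((g : Matrix (Fin 2) (Fin 2) F))ᵀ) = Submodule.span 𝒪[F] (Set.range ((g' : Matrix (Fin 2) (Fin 2) F))ᵀ) ↔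
      k = k' ∧ l = l' ∧ ϖ ^ (-k) * (y' - y) ∈ 𝒪[F] := by
  have h0 := hϖ.ne_zero
  have hm : ((g⁻¹ * g' : GL (Fin 2) F) : Matrix (Fin 2) (Fin 2) F) = !![ϖ ^ (k' - k), (ϖ ^ k)⁻¹ * (y' - y * (ϖ ^ l)⁻¹ * ϖ ^ l'); 0, ϖ ^ (l' - l)] := by
    rw [Units.val_mul, Matrix.coe_units_inv, hg, hg', upperTriangular_inv_mul (zpow_ne_zero k h0) (zpow_ne_zero l h0),
      zpow_uniformizer_inv_mul_zpow hϖ, zpow_uniformizer_inv_mul_zpow hϖ]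
  rw [span_range_transpose_eq_iff, mem_glInt_of_upperTriangular_iff _ hm, valuation_zpow_uniformizer_eq_one_iff hϖ,
    valuation_zpow_uniformizer_eq_one_iff hϖ, sub_eq_zero, sub_eq_zero, ← _root_.zpow_neg]
  constructor
  · rintro ⟨h1, h2, h3⟩
    refine ⟨h1.symm, h2.symm, ?_⟩
    rwa [h2, mul_assoc y, inv_mul_cancel₀ (zpow_ne_zero l h0), mul_one] at h3
  · rintro ⟨rfl, rfl, h3⟩
    refine ⟨rfl, rfl, ?_⟩
    rwa [mul_assoc y, inv_mul_cancel₀ (zpow_ne_zero l h0), mul_one]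

include hϖ in
/-- Consequently the corner may be changed modulo `ϖ^k 𝒪`: `ϖ^{−k}(y′ − y) ∈ 𝒪 → Λ(T(k,y,l)) = Λ(T(k,y′,l))`. [cite: Macdonald1995, Ch. V §2] -/
theorem span_eq_span_of_hermite_of_sub_mem {k l : ℤ} {y y' : F} (g g' : GL (Fin 2) F)
    (hg : (g : Matrix (Fin 2) (Fin 2) F) = !![ϖ ^ k, y; 0, ϖ ^ l]) (hg' : (g' : Matrix (Fin 2) (Fin 2) F) = !![ϖ ^ k, y'; 0, ϖ ^ l])
    (h : ϖ ^ (-k) * (y' - y) ∈ 𝒪[F]) :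
    Submodule.span 𝒪[F] (Set.range ((g : Matrix (Fin 2) (Fin 2) F))ᵀ) = Submodule.span 𝒪[F] (Set.range ((g' : Matrix (Fin 2) (Fin 2) F))ᵀ) :=
  (span_eq_span_iff_of_hermite hϖ g g' hg hg').2 ⟨rfl, rfl, h⟩

end Uniqueness

/-! ## §3 Stability under a diagonal element -/

section Stability

include hϖ in
/-- **`diag(a,c)·Λ(T(k,y,l)) = Λ(T(k,y,l)) ↔ ϖ^{−k}((a − c) y) ∈ 𝒪`** for `|a| = |c| = 1` (★ `map_span_range_transpose_eq_self_iff`: stable iff `T⁻¹ diag(a,c) T ∈ GL₂(𝒪)`;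
that matrix is `!![a, ϖ^{−k}(a − c) y; 0, c]`).  For `y = ϖ^{−(k+e)} u`, `u` a unit, the condition is `v(a − c) ≥ 2k + e` («gap ≤ N»).
[cite: Macdonald1995, Ch. V §2] [cite: Flicker1998UnitaryFL, §6 p. 95] -/
theorem map_diag_span_eq_self_iff_of_hermite {k l : ℤ} {y a c : F} (γ g : GL (Fin 2) F)
    (hγ : (γ : Matrix (Fin 2) (Fin 2) F) = !![a, 0; 0, c]) (ha : valuation F a = 1) (hc : valuation F c = 1)
    (hg : (g : Matrix (Fin 2) (Fin 2) F) = !![ϖ ^ k, y; 0, ϖ ^ l]) :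
    (Submodule.span 𝒪[F] (Set.range ((g : Matrix (Fin 2) (Fin 2) F))ᵀ)).map
        ((Matrix.toLin' (γ : Matrix (Fin 2) (Fin 2) F)).restrictScalars 𝒪[F]) =
      Submodule.span 𝒪[F] (Set.range ((g : Matrix (Fin 2) (Fin 2) F))ᵀ) ↔ ϖ ^ (-k) * ((a - c) * y) ∈ 𝒪[F] := by
  have h0 := hϖ.ne_zero
  have hm : ((g⁻¹ * γ * g : GL (Fin 2) F) : Matrix (Fin 2) (Fin 2) F) = !![a, (ϖ ^ k)⁻¹ * ((a - c) * y); 0, c] := by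
    rw [Units.val_mul, Units.val_mul, Matrix.coe_units_inv, hg, hγ, upperTriangular_inv_mul_diag_mul (zpow_ne_zero k h0) (zpow_ne_zero l h0)]
  rw [map_span_range_transpose_eq_self_iff, mem_glInt_of_upperTriangular_iff _ hm, ← _root_.zpow_neg]
  exact ⟨fun h => h.2.2, fun h => ⟨ha, hc, h⟩⟩

end Stability

/-! ## §4 Existence of the Hermite form (discrete valuation ring) -/

section Existence

variable [IsDiscreteValuationRing 𝒪[F]]

include hϖ in
/-- **Every plane lattice has a Hermite form**: for `h ∈ GL₂(F)` there are `k l : ℤ`, `y : F` and `g ∈ GL₂(F)` with matrix `T(k,y,l) = !![ϖ^k, y; 0, ϖ^l]` and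
`Λ(h) = Λ(g)` (Iwasawa `h = u · ϖ^m · κ`, `κ ∈ GL₂(𝒪)`, ★ `exists_unipotent_mul_zpowDiagGL_mul_glInt`; `g = u ϖ^m`).
[cite: Bump1997, Prop. 4.5.2] [cite: Macdonald1995, Ch. V §2 (2.6)] -/
theorem exists_hermite_span_eq (h : GL (Fin 2) F) :
    ∃ (k l : ℤ) (y : F) (g : GL (Fin 2) F), (g : Matrix (Fin 2) (Fin 2) F) = !![ϖ ^ k, y; 0, ϖ ^ l] ∧
      Submodule.span 𝒪[F] (Set.range ((h : Matrix (Fin 2) (Fin 2) F))ᵀ) = Submodule.span 𝒪[F] (Set.range ((g : Matrix (Fin 2) (Fin 2) F))ᵀ) := by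
  obtain ⟨u, hu, m, κ, hκ, rfl⟩ := exists_unipotent_mul_zpowDiagGL_mul_glInt hϖ h
  obtain ⟨hut, hud⟩ := (mem_upperUnitriangular_iff u).1 hu
  refine ⟨m 0, m 1, (u : Matrix (Fin 2) (Fin 2) F) 0 1 * ϖ ^ m 1, u * zpowDiagGL hϖ.ne_zero m, ?_, ?_⟩
  · rw [Units.val_mul, coe_zpowDiagGL]
    ext i j
    have h10 : (u : Matrix (Fin 2) (Fin 2) F) 1 0 = 0 := hut (by decide : (id (0 : Fin 2)) < id 1)
    fin_cases i <;> fin_cases j <;>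
      simp [Matrix.mul_apply, Fin.sum_univ_two, Matrix.diagonal_apply_eq, Matrix.diagonal_apply_ne, hud, h10]
  · rw [span_range_transpose_eq_iff, _root_.mul_inv_rev, _root_.mul_inv_rev, mul_assoc, mul_assoc, inv_mul_cancel_left, inv_mul_cancel, mul_one]
    exact inv_mem hκ

end Existence

end Literature.NumberTheory.Automorphic

end
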